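import Summits.CriticalPhenomena.PercolationContinuityZ3.Theorems.PercNearOneGluingNoHeavyLowerTailThreePointVarianceRefutationTransport
import Summits.CriticalPhenomena.PercolationContinuityZ3.Theorems.PercNearOneGluingNoHeavyLowerTailThreePointPieces
import HarnessLib

/-!
# Piece charts: identifying the cylinder events of a piece with events of a model graph

Support file for crux `stmt-CriticalPhenomena-4575` (`NoHeavyLowerTail`, closed), seat `prim-nh-lead-4575` gen 114
(`--supports stmt-CriticalPhenomena-4575`); fourth of the files refuting the three-point variance row `(3PT)`.
GENERIC in the vertex type (so that nothing here ever unfolds a concrete `Finset.univ`): for prim-l12-p1 gen 20's piece structures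
(`ThreePointPieces`: terminals `a b c`, labelling `part : V → ι`, piece pair sets `piecePairs`, cylinder events `pieceConn`, `isoPiece`)
a PIECE CHART is a family of injections `φ j : V₀ → V` from one model vertex type `V₀` with a "terminal" predicate `T`, mapping the
`T`-vertices onto the terminals and the other vertices onto piece `j` (`IsPieceChart`).  Then [this work]:
* `preimage_piecePairs`: the pairs of piece `j` pull back to the model's NON-TERMINAL pairs `ntpSet T` (distinct ends, not both terminal),
  and lie in the range of `Sym2.map (φ j)` (`piecePairs_subset_range`);
* `isoPiece_chart`: `isoPiece (piecePairs a b c part j) (φ j p) (φ j q) (φ j r)` is the pull-back (`comapConf`, transport file) of the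
  model event `E0 T p q r` = "`p` reaches neither `q` nor `r` through open non-terminal pairs" — by the reachability transport
  `openGraph_reachable_iff_comap`.
No named facts, no sorries, standard axioms.
-/

namespace Summit.CriticalPhenomena.PercolationContinuityZ3.Theorems.ThreePointVarianceRefutation

open Set Literature.Probability.Percolation
open Summit.CriticalPhenomena.PercolationContinuityZ3.Theorems.ThreePointPieces

variable {V₀ V : Type*} [Fintype V] [DecidableEq V] {ι : Type*} [Fintype ι] [DecidableEq ι]

/-- The NON-TERMINAL pairs of the model: distinct ends, at least one end not a terminal. [this work] -/
def ntpSet (T : V₀ → Prop) : Set (Sym2 V₀) := {e | ¬ e.IsDiag ∧ ¬ ∀ v ∈ e, T v}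

omit [Fintype V] [DecidableEq V] [Fintype ι] [DecidableEq ι] in
/-- Membership of a pair in `ntpSet`. [this work] -/
theorem mk_mem_ntpSet {T : V₀ → Prop} {p q : V₀} : s(p, q) ∈ ntpSet T ↔ p ≠ q ∧ (¬ T p ∨ ¬ T q) := by
  simp only [ntpSet, mem_setOf_eq, Sym2.mk_isDiag_iff, Sym2.mem_iff, forall_eq_or_imp, forall_eq, not_and_or]

/-- The model event "`p` is joined to neither `q` nor `r` through open non-terminal pairs". [this work] -/
def E0 (T : V₀ → Prop) (p q r : V₀) : Set (Set (Sym2 V₀)) :=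
  {ω | ¬ (openGraph (ω ∩ ntpSet T)).Reachable p q ∧ ¬ (openGraph (ω ∩ ntpSet T)).Reachable p r}

/-- **A piece chart**: injections `φ j : V₀ → V` sending the `T`-vertices into the terminals `a, b, c` and the other vertices into
piece `j`, jointly onto terminals and piece. [this work] -/
structure IsPieceChart (a b c : V) (part : V → ι) (T : V₀ → Prop) (φ : ι → V₀ → V) : Prop where
  /-- each chart is injective -/
  inj : ∀ j, Function.Injective (φ j)
  /-- exactly the `T`-vertices go to terminals -/
  term_iff : ∀ j p, φ j p ∈ terms a b c ↔ T p
  /-- the other vertices go to piece `j` -/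
  part_eq : ∀ j p, ¬ T p → part (φ j p) = j
  /-- every vertex of piece `j` is hit -/
  surj_piece : ∀ j u, u ∉ terms a b c → part u = j → ∃ p, φ j p = u
  /-- every terminal is hit -/
  surj_term : ∀ j u, u ∈ terms a b c → ∃ p, φ j p = u

variable {a b c : V} {part : V → ι} {T : V₀ → Prop} {φ : ι → V₀ → V}

omit [Fintype ι] in
/-- The pairs of piece `j` lie in the range of `Sym2.map (φ j)`. [this work] -/
theorem piecePairs_subset_range (H : IsPieceChart a b c part T φ) (j : ι) :
    (↑(piecePairs a b c part j) : Set (Sym2 V)) ⊆ Set.range (Sym2.map (φ j)) := by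
  intro e he
  rw [Finset.mem_coe, mem_piecePairs] at he
  obtain ⟨u, v, ⟨hu, hpu⟩, hv, -, rfl⟩ := he
  obtain ⟨p, rfl⟩ := H.surj_piece j u hu hpu
  obtain ⟨q, rfl⟩ : ∃ q, φ j q = v := by
    rcases hv with ⟨hv1, hv2⟩ | hv
    · exact H.surj_piece j v hv1 hv2
    · exact H.surj_term j v hv
  exact ⟨s(p, q), by rw [Sym2.map_mk]⟩

omit [Fintype ι] in
/-- **The pairs of piece `j` pull back to the model's non-terminal pairs.** [this work] -/
theorem preimage_piecePairs (H : IsPieceChart a b c part T φ) (j : ι) :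
    Sym2.map (φ j) ⁻¹' ↑(piecePairs a b c part j) = ntpSet T := by
  ext e
  induction e using Sym2.ind with
  | h p q =>
    rw [Set.mem_preimage, Sym2.map_mk, Finset.mem_coe, mk_mem_ntpSet]
    constructor
    · intro h
      rw [mem_piecePairs] at h
      obtain ⟨u, v, ⟨hu, -⟩, -, huv, he⟩ := h
      have key : ∀ p q : V₀, φ j p = u → φ j q = v → p ≠ q ∧ (¬ T p ∨ ¬ T q) := by
        intro p q hp hq
        exact ⟨fun hpq => huv (by rw [← hp, ← hq, hpq]), Or.inl fun hT => hu (hp ▸ (H.term_iff j p).2 hT)⟩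
      rcases Sym2.eq_iff.1 he with ⟨hp, hq⟩ | ⟨hp, hq⟩
      · exact key p q hp hq
      · obtain ⟨h1, h2⟩ := key q p hq hp
        exact ⟨Ne.symm h1, h2.symm⟩
    · intro hh
      have mk : ∀ p q : V₀, p ≠ q → ¬ T p → s(φ j p, φ j q) ∈ piecePairs a b c part j := by
        intro p q hpq hp
        refine mk_mem_piecePairs (fun h => hp ((H.term_iff j p).1 h)) (H.part_eq j p hp) ?_ ((H.inj j).ne hpq)
        by_cases hq : T q
        · exact Or.inr ((H.term_iff j q).2 hq)
        · exact Or.inl ⟨fun h => hq ((H.term_iff j q).1 h), H.part_eq j q hq⟩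
      rcases hh.2 with h | h
      · exact mk p q hh.1 h
      · rw [Sym2.eq_swap]; exact mk q p (Ne.symm hh.1) h

omit [Fintype ι] in
/-- `pieceConn` of piece `j` between chart vertices is the pull-back of model reachability through `ntpSet T`. [this work] -/
theorem pieceConn_chart (H : IsPieceChart a b c part T φ) (j : ι) (p q : V₀) :
    pieceConn (piecePairs a b c part j) (φ j p) (φ j q) =
      comapConf (Sym2.map (φ j)) ⁻¹' {ω | (openGraph (ω ∩ ntpSet T)).Reachable p q} := by
  ext ω
  rw [Set.mem_preimage, Set.mem_setOf_eq]
  show (openGraph (ω ∩ ↑(piecePairs a b c part j))).Reachable (φ j p) (φ j q) ↔ _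
  rw [openGraph_reachable_iff_comap (H.inj j) (piecePairs_subset_range H j) ω p q, preimage_piecePairs H]

omit [Fintype ι] in
/-- **`isoPiece` of piece `j` at chart vertices is the pull-back of the model event `E0`.** [this work] -/
theorem isoPiece_chart (H : IsPieceChart a b c part T φ) (j : ι) (p q r : V₀) :
    isoPiece (piecePairs a b c part j) (φ j p) (φ j q) (φ j r) = comapConf (Sym2.map (φ j)) ⁻¹' E0 T p q r := by
  unfold isoPiece
  rw [pieceConn_chart H, pieceConn_chart H]
  ext ω
  simp [E0]

end Summit.CriticalPhenomena.PercolationContinuityZ3.Theorems.ThreePointVarianceRefutation
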